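import Literature.MathematicalPhysics.QuantumFieldTheory.BalabanImbrieJaffe1984to88.BIJ88Ineq217Mechanism
import Literature.MathematicalPhysics.QuantumFieldTheory.BalabanImbrieJaffe1984to88.BIJ88Ineq217NearPart

/-!
# `BalabanImbrieJaffe1984to88.BIJ88Ineq217NearSupport` — T. Bałaban, J. Imbrie, A. Jaffe, *Effective action and cluster properties of
the abelian Higgs model*, Commun. Math. Phys. **114** (1988) 257–315 [BalabanImbrieJaffe1988]: the SUPPORT of the near part `∂□A′` of the
argument for **(2.17)** p. 262 on the torus carriers — it lives on the plaquettes based in the box enlarged by one lattice step, at most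
`d²(n+2)^d` of them — the datum the `ℓ²` reading of «σ_k is a bounded operator on curls» (`BIJ88Ineq217Mechanism.abs_ineq217_l2`) consumes

statement-level skeleton of published theorems with citation tags; proofs where landed; nothing here is a claim about the Yang–Mills mass gap

PDF held: `paper:balaban1988-cmp114-bij-abelian-higgs-effective-action` (journal page = PDF page + 256); p. 262 [PDF 6] (render + text layer).

WHAT IS REPRODUCED.  SKELETON row **C2.Eq2.17** (cell `lit-balaban`, HOME `run/shared/lean/pub/lit-balaban/`; Phase-2 seat p08 gen 6 = unit
`lit-balaban-p08`; owner r18, referee ref-5), companion of `BIJ88Ineq217NearPart` (p253816): p. 262 *"Write f^{(k)} = ∂□A + f′, where □ is the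
characteristic function of a neighborhood … The near part is similarly bounded since σ_k is a bounded operator on curls [2]."* — in the `ℓ²`
reading of «bounded operator» the near part enters through `‖∂□A′‖₂ ≤ (#suppt)^{1/2}‖∂□A′‖_∞`, so its support must be counted.

WHAT IS PROVED HERE (0 `sorry`, standard axioms; theorems only).  For the box `[lo, hi]` (`hi ≤ lo + n`):
§1 `e_apply_le_one`, `src_eq_castSite_of_bond_mem` (a plaquette one of whose four bonds is a box bond is based at `castSite x′`, `lo − 1 ≤ x′ ≤ hi`),
**`nearCurl_eq_zero_of_not_mem`** (`∂□A′(p) = 0` unless `p` is based in the image of `[lo − 1, hi]`);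
§2 **`card_basedIn_le`** (the plaquettes based in the image of `[lo − 1, hi]` number at most `d·d·(n+2)^d`), and the PACKAGE for
`abs_ineq217_l2` on the centred box of radius `R`: **`nearCurl_support_centred`** / **`card_support_centred_le`** (`≤ d²(2R+2)^d`);
§3 **`abs_ineq217_torus_l2`** — (2.17) on the torus in the `ℓ²` READING of «σ_k is a bounded operator on curls» (`‖σg‖₂ ≤ M‖g‖₂` for curls
`g = ∂^{c}B`), with (2.16) at `p₁` beyond `R`, row sum `S`, and the printed hypothesis `f = ∂^{c}A` on the box of radius `R` about `p₁.src`: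
`|(σf)(p₁)| ≤ (M·(d²(2R+2)^d)^{1/2}·8(d−1)R + c₀S(1 + 8(d−1)R))·‖f‖_∞` (sibling of the sup-reading `BIJ88Ineq217Torus.abs_ineq217_torus`, p254138).
HONEST SCOPE.  Counting + assembly only; (2.16) and the `ℓ²` bound of σ_k on curls ([2]) stay displayed hypotheses.  NOT summit progress.
-/

namespace Literature.MathematicalPhysics.QuantumFieldTheory.BalabanImbrieJaffe1984to88.BIJ88Ineq217NearSupport

open Balaban1983to89 hiding Site Plaq
open Balaban1983to89.LatticeFieldCalculus Balaban1983to89.T4AxialGaugeSmallField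
open BIJ88Sect2Statements BIJ88Ineq217Mechanism BIJ88Ineq217NearPart
open Balaban1983to89.B7Prop1Explicit (e e_apply)
open Balaban1983to89.B8Lemma1NonAbelian (e_nonneg)
-- fresh names for the torus carriers of `Setup` (the bare `Site`/`Plaq` are shadowed inside this namespace, cf. `BIJ88Ineq217NearPart`)
open Balaban1983to89 renaming Site → TSite, Plaq → TPlaq

noncomputable section

variable {P : Params} {j : ℕ}

/-! ## §1  Where the near part can be nonzero -/

/-- A unit vector has coordinates `≤ 1`. [cite: BalabanImbrieJaffe1988, (2.17) p.262] -/
theorem e_apply_le_one {d : ℕ} (μ κ : Fin d) : e μ κ ≤ 1 := by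
  rw [e_apply]; split_ifs <;> omega

/-- If one of the four bonds of `p` is a bond of the box `[lo, hi]`, then `p` is based at `castSite x′` with `lo − 1 ≤ x′ ≤ hi`.
[cite: BalabanImbrieJaffe1988, (2.17) p.262] -/
theorem src_eq_castSite_of_bond_mem {lo hi : Fin P.d → ℤ} {p : TPlaq P j}
    (h : (⟨p.src, p.μ⟩ : PBond P j) ∈ boxBonds lo hi ∨ (⟨p.src.shift p.μ, p.ν⟩ : PBond P j) ∈ boxBonds lo hi ∨
      (⟨p.src.shift p.ν, p.μ⟩ : PBond P j) ∈ boxBonds lo hi ∨ (⟨p.src, p.ν⟩ : PBond P j) ∈ boxBonds lo hi) :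
    ∃ x' : Fin P.d → ℤ, lo - 1 ≤ x' ∧ x' ≤ hi ∧ p.src = castSite x' := by
  have hle : ∀ {x : Fin P.d → ℤ} {μ : Fin P.d}, lo ≤ x → x + e μ ≤ hi → lo - 1 ≤ x ∧ x ≤ hi := by
    intro x μ hx hxμ
    refine ⟨fun κ => ?_, fun κ => ?_⟩
    · have := hx κ; simp only [Pi.sub_apply, Pi.one_apply]; linarith
    · have h1 := hxμ κ; have h2 := e_nonneg μ κ; simp only [Pi.add_apply, Pi.zero_apply] at h1 h2; linarith
  have hshift : ∀ {x : Fin P.d → ℤ} {μ ν : Fin P.d}, lo ≤ x → x + e ν ≤ hi → p.src.shift μ = castSite x →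
      ∃ x' : Fin P.d → ℤ, lo - 1 ≤ x' ∧ x' ≤ hi ∧ p.src = castSite x' := by
    intro x μ ν hx hxν hs
    refine ⟨x - e μ, fun κ => ?_, fun κ => ?_, ?_⟩
    · have h1 := hx κ; have h2 := e_apply_le_one μ κ; simp only [Pi.sub_apply, Pi.one_apply]; linarith
    · have h1 := hxν κ; have h2 := e_nonneg ν κ; have h3 := e_nonneg μ κ
      simp only [Pi.add_apply, Pi.zero_apply, Pi.sub_apply] at h1 h2 h3 ⊢; linarith
    · have hc : (castSite x : TSite P j) = (castSite (x - e μ)).shift μ := by rw [← castSite_add_e, sub_add_cancel]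
      rw [hc] at hs
      exact (shiftEquiv μ).injective (show shiftEquiv μ p.src = shiftEquiv μ (castSite (x - e μ)) from hs)
  rcases h with ⟨x, hx, hxμ, hs⟩ | ⟨x, hx, hxν, hs⟩ | ⟨x, hx, hxμ, hs⟩ | ⟨x, hx, hxν, hs⟩
  · exact ⟨x, (hle hx hxμ).1, (hle hx hxμ).2, hs⟩
  · exact hshift hx hxν hs
  · exact hshift hx hxμ hs
  · exact ⟨x, (hle hx hxν).1, (hle hx hxν).2, hs⟩

/-- **The near part vanishes off the enlarged box**: if `p` is not based at a point `castSite x′` with `lo − 1 ≤ x′ ≤ hi`, then none of its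
bonds is a box bond and `∂□A′(p) = 0`. [cite: BalabanImbrieJaffe1988, (2.17) p.262] -/
theorem nearCurl_eq_zero_of_not_mem (c : ℝ) (A : VecField P j ℝ) {lo hi : Fin P.d → ℤ} {p : TPlaq P j}
    (hp : ¬ ∃ x' : Fin P.d → ℤ, lo - 1 ≤ x' ∧ x' ≤ hi ∧ p.src = castSite x') : nearCurl c A lo hi p = 0 := by
  have h1 : (⟨p.src, p.μ⟩ : PBond P j) ∉ boxBonds lo hi := fun h => hp (src_eq_castSite_of_bond_mem (Or.inl h))
  have h2 : (⟨p.src.shift p.μ, p.ν⟩ : PBond P j) ∉ boxBonds lo hi :=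
    fun h => hp (src_eq_castSite_of_bond_mem (Or.inr (Or.inl h)))
  have h3 : (⟨p.src.shift p.ν, p.μ⟩ : PBond P j) ∉ boxBonds lo hi :=
    fun h => hp (src_eq_castSite_of_bond_mem (Or.inr (Or.inr (Or.inl h))))
  have h4 : (⟨p.src, p.ν⟩ : PBond P j) ∉ boxBonds lo hi :=
    fun h => hp (src_eq_castSite_of_bond_mem (Or.inr (Or.inr (Or.inr h))))
  simp only [nearCurl, curl, boxCut_of_not_mem _ h1, boxCut_of_not_mem _ h2, boxCut_of_not_mem _ h3, boxCut_of_not_mem _ h4,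
    add_zero, sub_zero, smul_zero]

/-! ## §2  Counting the plaquettes based in the enlarged box -/

/-- The plaquettes based in the image of the `ℤ^d` order interval `[a, b]` are at most `d·d·#[a, b]`: inject `p ↦ (p.src, μ, ν)`.
[cite: BalabanImbrieJaffe1988, (2.17) p.262] -/
theorem card_filter_src_mem_le (a b : Fin P.d → ℤ) :
    ((Finset.univ : Finset (TPlaq P j)).filter fun p => ∃ x ∈ Finset.Icc a b, p.src = castSite x).card
      ≤ P.d * P.d * (Finset.Icc a b).card := by
  classical
  set T : Finset (TSite P j × Fin P.d × Fin P.d) :=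
    ((Finset.Icc a b).image fun x => (castSite x : TSite P j)) ×ˢ (Finset.univ ×ˢ Finset.univ) with hT
  have hmap : ∀ p ∈ (Finset.univ : Finset (TPlaq P j)).filter (fun p => ∃ x ∈ Finset.Icc a b, p.src = castSite x),
      (fun p : TPlaq P j => (p.src, p.μ, p.ν)) p ∈ T := by
    intro p hp
    rw [Finset.mem_filter] at hp
    obtain ⟨x, hx, hs⟩ := hp.2
    simp only [hT, Finset.mem_product, Finset.mem_image, Finset.mem_univ, and_true]
    exact ⟨x, hx, hs.symm⟩
  have hinj : Set.InjOn (fun p : TPlaq P j => (p.src, p.μ, p.ν))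
      ↑((Finset.univ : Finset (TPlaq P j)).filter fun p => ∃ x ∈ Finset.Icc a b, p.src = castSite x) := by
    rintro ⟨s, μ, ν, h⟩ _ ⟨s', μ', ν', h'⟩ _ hh
    simp only [Prod.mk.injEq] at hh
    obtain ⟨rfl, rfl, rfl⟩ := hh
    rfl
  refine (Finset.card_le_card_of_injOn _ hmap hinj).trans ?_
  rw [hT, Finset.card_product, Finset.card_product, Finset.card_univ, Fintype.card_fin]
  calc ((Finset.Icc a b).image fun x => (castSite x : TSite P j)).card * (P.d * P.d)
      ≤ (Finset.Icc a b).card * (P.d * P.d) := Nat.mul_le_mul_right _ Finset.card_image_le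
    _ = P.d * P.d * (Finset.Icc a b).card := by ring

/-- The order interval `[lo − 1, hi]` of `ℤ^d` with `hi ≤ lo + n` has at most `(n+2)^d` points. [cite: BalabanImbrieJaffe1988, (2.17) p.262] -/
theorem card_Icc_enlarged_le {lo hi : Fin P.d → ℤ} {n : ℕ} (hn : ∀ κ, hi κ ≤ lo κ + n) :
    (Finset.Icc (lo - 1) hi).card ≤ (n + 2) ^ P.d := by
  rw [Pi.card_Icc]
  calc ∏ κ, (Finset.Icc ((lo - 1) κ) (hi κ)).card ≤ ∏ _κ : Fin P.d, (n + 2) := by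
        refine Finset.prod_le_prod' fun κ _ => ?_
        rw [Int.card_Icc]
        have := hn κ
        simp only [Pi.sub_apply, Pi.one_apply]
        omega
    _ = (n + 2) ^ P.d := by rw [Finset.prod_const, Finset.card_univ, Fintype.card_fin]

/-- **The support count**: the plaquettes based in the image of `[lo − 1, hi]` (`hi ≤ lo + n`) number at most `d·d·(n+2)^d`.
[cite: BalabanImbrieJaffe1988, (2.17) p.262] -/
theorem card_basedIn_le {lo hi : Fin P.d → ℤ} {n : ℕ} (hn : ∀ κ, hi κ ≤ lo κ + n) :
    ((Finset.univ : Finset (TPlaq P j)).filter fun p => ∃ x ∈ Finset.Icc (lo - 1) hi, p.src = castSite x).card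
      ≤ P.d * P.d * (n + 2) ^ P.d :=
  (card_filter_src_mem_le _ _).trans (Nat.mul_le_mul_left _ (card_Icc_enlarged_le hn))

/-- The near part vanishes off the counted set (the `hs` of `BIJ88Ineq217Mechanism.abs_ineq217_l2`). [cite: BalabanImbrieJaffe1988, (2.17) p.262] -/
theorem nearCurl_support (c : ℝ) (A : VecField P j ℝ) (lo hi : Fin P.d → ℤ) :
    ∀ p ∉ (Finset.univ : Finset (TPlaq P j)).filter (fun p => ∃ x ∈ Finset.Icc (lo - 1) hi, p.src = castSite x),
      nearCurl c A lo hi p = 0 := by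
  intro p hp
  refine nearCurl_eq_zero_of_not_mem c A fun ⟨x', h1, h2, h3⟩ => hp ?_
  exact Finset.mem_filter.2 ⟨Finset.mem_univ _, x', Finset.mem_Icc.2 ⟨h1, h2⟩, h3⟩

/-- **Package, centred box of radius `R`**: support set for `∂□A′` … [cite: BalabanImbrieJaffe1988, (2.17) p.262] -/
theorem nearCurl_support_centred (c : ℝ) (A : VecField P j ℝ) (z₁ : Fin P.d → ℤ) (R : ℕ) :
    ∀ p ∉ (Finset.univ : Finset (TPlaq P j)).filter
        (fun p => ∃ x ∈ Finset.Icc (loOf z₁ R - 1) (hiOf z₁ R), p.src = castSite x),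
      nearCurl c A (loOf z₁ R) (hiOf z₁ R) p = 0 :=
  nearCurl_support c A _ _

/-- … and its cardinality `≤ d²(2R+2)^d` (the `hn` of `abs_ineq217_l2`). [cite: BalabanImbrieJaffe1988, (2.17) p.262] -/
theorem card_support_centred_le (z₁ : Fin P.d → ℤ) (R : ℕ) :
    ((Finset.univ : Finset (TPlaq P j)).filter
        (fun p => ∃ x ∈ Finset.Icc (loOf z₁ R - 1) (hiOf z₁ R), p.src = castSite x)).card ≤ P.d * P.d * (2 * R + 2) ^ P.d :=
  card_basedIn_le (hiOf_le z₁ R)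

/-! ## §3  (2.17) on the torus in the `ℓ²` reading of «σ_k is a bounded operator on curls» -/

/-- **(2.17) on the torus carriers, `ℓ²` reading.**  `σ` a kernel on `Plaq P j` with (2.16) at `p₁` beyond `R` (rate `δ`, row sum `≤ S`) and
`‖σg‖₂ ≤ M‖g‖₂` on curls `g = ∂^{c}B`; `f = ∂^{c}A` on the box of radius `R` about the base point of `p₁` (`2R < sitesPerDir j`, `c ≠ 0`).  Then
`|(σf)(p₁)| ≤ (M·(d·d·(2R+2)^d)^{1/2}·8(d−1)R + c₀S(1 + 8(d−1)R))·‖f‖_∞` — `BIJ88Ineq217Mechanism.abs_ineq217_l2` with the near part `∂□A′` of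
`BIJ88Ineq217NearPart` and the support count of §2. [cite: BalabanImbrieJaffe1988, (2.17) p.262] -/
theorem abs_ineq217_torus_l2 {σ : TPlaq P j → TPlaq P j → ℝ} {c₀ δ M S c : ℝ} (hc₀ : 0 ≤ c₀) (hM : 0 ≤ M) (hc : c ≠ 0) {R : ℕ}
    (hR : 2 * R < P.sitesPerDir j) {p₁ : TPlaq P j} {z₁ : Fin P.d → ℤ} (h₁ : p₁.src = castSite z₁)
    (h216 : ∀ p₂, (R : ℝ) ≤ pdist p₁ p₂ → |σ p₁ p₂| ≤ c₀ * Real.exp (-δ * pdist p₁ p₂))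
    (hS : ∑ p₂, Real.exp (-δ * pdist p₁ p₂) ≤ S)
    (hV2 : ∀ g ∈ Set.range (curl c : VecField P j ℝ → TPlaq P j → ℝ), ∑ p, applyK σ g p ^ 2 ≤ M ^ 2 * ∑ p, g p ^ 2)
    {f : TPlaq P j → ℝ} {A : VecField P j ℝ} (hf : ∀ p ∈ boxPlaqs (loOf z₁ R) (hiOf z₁ R), f p = curl c A p) :
    |applyK σ f p₁| ≤ (M * Real.sqrt ((P.d * P.d * (2 * R + 2) ^ P.d : ℕ) : ℝ) * (8 * ((P.d - 1 : ℕ) : ℝ) * R)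
        + c₀ * S * (1 + 8 * ((P.d - 1 : ℕ) : ℝ) * R)) * supNorm f :=
  abs_ineq217_l2 hc₀ hM h216 hS hV2 (nearCurl_mem_range c A _ _) (nearCurl_support_centred c A z₁ R) (card_support_centred_le z₁ R)
    (nearCurl_agree_of_pdist_lt h₁ hf) (supNorm_nearCurl_le_centred hc hR hf)

end

end Literature.MathematicalPhysics.QuantumFieldTheory.BalabanImbrieJaffe1984to88.BIJ88Ineq217NearSupport
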